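import Summits.Parity.GeneralizedHardyLittlewood.Theorems.LeeYangFibresRelativeDimOneTypeDefs
import Summits.Parity.GeneralizedHardyLittlewood.Theorems.LeeYangFibresRelativeDimOneSplitDictionary
import Summits.Parity.GeneralizedHardyLittlewood.Theorems.LeeYangFibresRelativeDimOneSplitTranslation
import Summits.Parity.GeneralizedHardyLittlewood.Theorems.LeeYangFibresRelativeDimOneSplitCosetMean
import HarnessLib

/-!
# Type data for the reshaped line `gallagher-backwards-split` (crux stmt-Parity-14113
`LeeYangFibres.RelativeDimOne`, stub `stub_typeData`), PART B: the data box and block summation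

* THE DATA BOX at scale `N` for multipliers `|a_i| ≤ L`: shifts `b ∈ ∏_i [u_i, u_i + N]` with RAPIDLY INCREASING
  corners `u_i = (2L+2)^{i+1} N`. Every shift vector of the box is NON-DEGENERATE
  (`nondeg_of_mem_box`: `|a_j b_i| < |a_i b_j|` for `i < j`), has size `‖sys a b‖_N ≤ t((2L+2)^t + L + 1)`
  (`affLinSize_le_of_mem_box`), all forms are positive on the window `[0, N − 1]` (`pos_on_window_of_mem_box`),
  and the moving windows sit at heights in `[N + 1, ((2L+2)^t + L + 1) N]` (`heights_of_window`);
* transport of box sums to `ℕ^t` (`sum_box_natCast`) and Gallagher's BLOCK SUMMATION WITH REMAINDER for an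
  `M`-periodic function over a box with `S` points a side, `m M ≤ S ≤ (m+1) M`
  (`block_sum_remainder`, `block_sum_le`; registered hook `typeData_blockSum`).
-/

noncomputable section

open scoped BigOperators Classical
open Finset Literature.NumberTheory.Sieve
open Summit.Parity.GeneralizedHardyLittlewood.Cruxes.RelativeDimOne.GallagherBackwardsSplit

namespace Summit.Parity.GeneralizedHardyLittlewood.Cruxes.RelativeDimOne.TypeSplit

namespace TypeDataProof

variable {t : ℕ}

/-! ### The data box -/

/-- The data box at scale `N` has corners `u_i = (2L+2)^{i+1} N` (height multipliers `(2L+2)^{i+1}`, written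
out throughout) and sides `N`: `box (fun i => (2L+2)^{i+1} N) (fun _ => N)`. First, `2L + 2 ≤ (2L+2)^{i+1}`. -/
theorem hmul_ge (L : ℕ) (i : Fin t) : 2 * L + 2 ≤ (2 * L + 2) ^ (i.val + 1) := by
  calc 2 * L + 2 = (2 * L + 2) ^ 1 := (pow_one _).symm
    _ ≤ (2 * L + 2) ^ (i.val + 1) := Nat.pow_le_pow_right (by omega) (by omega)

/-- `(2L+2)^{i+1} ≤ (2L+2)^t`. -/
theorem hmul_le (L : ℕ) (i : Fin t) : (2 * L + 2) ^ (i.val + 1) ≤ (2 * L + 2) ^ t :=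
  Nat.pow_le_pow_right (by omega) (by have := i.isLt; omega)

/-- The multipliers grow by the factor `2L + 2`. -/
theorem hmul_growth (L : ℕ) {i j : Fin t} (hij : i.val < j.val) :
    (2 * L + 2) * (2 * L + 2) ^ (i.val + 1) ≤ (2 * L + 2) ^ (j.val + 1) := by
  calc (2 * L + 2) * (2 * L + 2) ^ (i.val + 1) = (2 * L + 2) ^ (i.val + 2) := by ring
    _ ≤ (2 * L + 2) ^ (j.val + 1) := Nat.pow_le_pow_right (by omega) (by omega)

/-- Membership in a box of shift vectors. -/
theorem mem_box_iff {u : Fin t → ℤ} {X : Fin t → ℕ} {b : Fin t → ℤ} :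
    b ∈ box u X ↔ ∀ i, u i ≤ b i ∧ b i ≤ u i + X i := by
  simp only [GallagherBackwardsSplit.box, Fintype.mem_piFinset, mem_Icc]

/-- In the data box, `|a_j b_i| < |a_i b_j|` for `i < j` (the corners increase rapidly). -/
theorem abs_lt_of_mem_box {L N : ℕ} {a b : Fin t → ℤ} (ha : ∀ i, a i ≠ 0 ∧ |a i| ≤ L)
    (hb : b ∈ box (fun i => (((2 * L + 2) ^ (i.val + 1) * N : ℕ) : ℤ)) (fun _ => N)) (hN : 1 ≤ N) {i j : Fin t}
    (hij : i.val < j.val) : |a j * b i| < |a i * b j| := by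
  rw [mem_box_iff] at hb
  obtain ⟨hbi1, hbi2⟩ := hb i
  obtain ⟨hbj1, -⟩ := hb j
  have hhi : (1 : ℤ) ≤ (2 * L + 2) ^ (i.val + 1) := by
    have := hmul_ge L i
    exact_mod_cast (show 1 ≤ (2 * L + 2) ^ (i.val + 1) by omega)
  have hgrow : (((2 * L + 2) * (2 * L + 2) ^ (i.val + 1) : ℕ) : ℤ) ≤ (2 * L + 2) ^ (j.val + 1) := by exact_mod_cast hmul_growth L hij
  have hai : 1 ≤ |a i| := Int.one_le_abs (ha i).1
  have haj : |a j| ≤ L := (ha j).2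
  have hbi0 : 0 ≤ b i := le_trans (by positivity) hbi1
  have hbj0 : 0 ≤ b j := le_trans (by positivity) hbj1
  have hN' : (1 : ℤ) ≤ N := by exact_mod_cast hN
  rw [abs_mul, abs_mul, abs_of_nonneg hbi0, abs_of_nonneg hbj0]
  push_cast at hbi1 hbi2 hbj1 hgrow
  have h1 : |a j| * b i ≤ (L : ℤ) * (((2 * L + 2) ^ (i.val + 1) : ℤ) * N + N) :=
    mul_le_mul haj hbi2 hbi0 (by positivity)
  have hA : 0 ≤ (L : ℤ) * N * (((2 * L + 2) ^ (i.val + 1) : ℤ) - 1) :=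
    mul_nonneg (by positivity) (by linarith)
  have hB : (2 : ℤ) ≤ 2 * ((2 * L + 2) ^ (i.val + 1) : ℤ) * N := by nlinarith
  have h2 : (L : ℤ) * (((2 * L + 2) ^ (i.val + 1) : ℤ) * N + N) < (2 * L + 2) * ((2 * L + 2) ^ (i.val + 1) : ℤ) * N := by nlinarith
  have h3 : (2 * (L : ℤ) + 2) * ((2 * L + 2) ^ (i.val + 1) : ℤ) * N ≤ b j :=
    le_trans (mul_le_mul_of_nonneg_right hgrow (by positivity)) hbj1
  have h4 : b j ≤ |a i| * b j := le_mul_of_one_le_left hbj0 hai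
  linarith

/-- Every shift vector of the data box gives a NON-DEGENERATE system (`N ≥ 1`). -/
theorem nondeg_of_mem_box {L N : ℕ} {a b : Fin t → ℤ} (ha : ∀ i, a i ≠ 0 ∧ |a i| ≤ L)
    (hb : b ∈ box (fun i => (((2 * L + 2) ^ (i.val + 1) * N : ℕ) : ℤ)) (fun _ => N)) (hN : 1 ≤ N) :
    IsNondegenerateSystem (sys a b) := by
  rw [isNondegenerateSystem_sys_iff]
  refine ⟨fun i => (ha i).1, fun i j hij heq => ?_⟩
  have habs : |a i * b j| = |a j * b i| := by rw [heq]
  rcases lt_or_gt_of_ne (fun h => hij (Fin.ext h)) with h | h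
  · exact absurd habs (abs_lt_of_mem_box ha hb hN h).ne'
  · exact absurd habs (abs_lt_of_mem_box ha hb hN h).ne

/-- The size of the systems of the data box: `‖sys a b‖_N ≤ t ((2L+2)^t + L + 1)`. -/
theorem affLinSize_le_of_mem_box {L N : ℕ} {a b : Fin t → ℤ} (ha : ∀ i, a i ≠ 0 ∧ |a i| ≤ L)
    (hb : b ∈ box (fun i => (((2 * L + 2) ^ (i.val + 1) * N : ℕ) : ℤ)) (fun _ => N)) (hN : 1 ≤ N) :
    affLinSize (sys a b) N ≤ ((t * ((2 * L + 2) ^ t + L + 1) : ℕ) : ℝ) := by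
  rw [affLinSize_sys]
  rw [mem_box_iff] at hb
  have hN' : (0 : ℝ) < N := by exact_mod_cast hN
  have h1 : ∀ i, |(a i : ℝ)| ≤ L := fun i => by exact_mod_cast (ha i).2
  have h2 : ∀ i, |(b i : ℝ) / N| ≤ (2 * L + 2 : ℝ) ^ t + 1 := by
    intro i
    obtain ⟨hlo, hhi⟩ := hb i
    have hb0 : (0 : ℝ) ≤ b i := by exact_mod_cast le_trans (by positivity) hlo
    rw [abs_of_nonneg (div_nonneg hb0 hN'.le), div_le_iff₀ hN']
    have hhi' : (b i : ℝ) ≤ ((2 * L + 2) ^ (i.val + 1) : ℝ) * N + N := by exact_mod_cast hhi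
    have hh : ((2 * L + 2) ^ (i.val + 1) : ℝ) ≤ (2 * L + 2 : ℝ) ^ t := by exact_mod_cast hmul_le L i
    nlinarith
  calc ∑ i, |(a i : ℝ)| + ∑ i, |(b i : ℝ) / N|
      ≤ ∑ _i : Fin t, (L : ℝ) + ∑ _i : Fin t, ((2 * L + 2 : ℝ) ^ t + 1) :=
        add_le_add (Finset.sum_le_sum fun i _ => h1 i) (Finset.sum_le_sum fun i _ => h2 i)
    _ = ((t * ((2 * L + 2) ^ t + L + 1) : ℕ) : ℝ) := by
        simp only [Finset.sum_const, Finset.card_univ, Fintype.card_fin, nsmul_eq_mul]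
        push_cast
        ring

/-- Every form of a system of the data box is positive on the window `[0, N − 1]`. -/
theorem pos_on_window_of_mem_box {L N : ℕ} {a b : Fin t → ℤ} (ha : ∀ i, a i ≠ 0 ∧ |a i| ≤ L)
    (hb : b ∈ box (fun i => (((2 * L + 2) ^ (i.val + 1) * N : ℕ) : ℤ)) (fun _ => N)) :
    ∀ i, ∀ x : ℝ, 0 ≤ x → x ≤ (N : ℝ) - 1 → 0 < (a i : ℝ) * x + b i := by
  intro i x hx0 hx1
  rw [mem_box_iff] at hb
  obtain ⟨hlo, -⟩ := hb i
  have hlo' : (((2 * L + 2) * N : ℕ) : ℝ) ≤ b i := by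
    have h1 : (((2 * L + 2) * N : ℕ) : ℤ) ≤ b i :=
      le_trans (by exact_mod_cast Nat.mul_le_mul_right N (hmul_ge L i)) hlo
    exact_mod_cast h1
  have ha' : |(a i : ℝ)| ≤ L := by exact_mod_cast (ha i).2
  have h2 : -(L : ℝ) * x ≤ (a i : ℝ) * x := by
    have := neg_abs_le (a i : ℝ)
    nlinarith
  have h3 : -(L : ℝ) * ((N : ℝ) - 1) ≤ -(L : ℝ) * x := by
    have hL : (0 : ℝ) ≤ L := Nat.cast_nonneg L
    nlinarith
  have h4 : (0 : ℝ) ≤ (L : ℝ) * N := by positivity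
  push_cast at hlo'
  nlinarith

/-- The moving windows of the data box sit at heights in `[N + 1, ((2L+2)^t + L + 1) N]` along `n < N`. -/
theorem heights_of_window {L N : ℕ} {a : Fin t → ℤ} (ha : ∀ i, a i ≠ 0 ∧ |a i| ≤ L) (i : Fin t) (n : ℕ)
    (hn : n < N) :
    (N : ℤ) + 1 ≤ a i * n + (((2 * L + 2) ^ (i.val + 1) * N : ℕ) : ℤ) ∧
      a i * n + (((2 * L + 2) ^ (i.val + 1) * N : ℕ) : ℤ) + N ≤ (((2 * L + 2) ^ t + L + 1 : ℕ) : ℤ) * N := by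
  have ha' := (ha i).2
  have h1 : -(L : ℤ) * n ≤ a i * n := by nlinarith [neg_abs_le (a i), abs_nonneg (a i)]
  have h2 : a i * n ≤ (L : ℤ) * n := by nlinarith [le_abs_self (a i)]
  have hn' : (n : ℤ) + 1 ≤ N := by exact_mod_cast hn
  have hL : (0 : ℤ) ≤ L := Nat.cast_nonneg L
  have hA : 0 ≤ (L : ℤ) * ((N : ℤ) - 1 - n) := mul_nonneg hL (by linarith)
  have hB : (0 : ℤ) ≤ (L : ℤ) * N := by positivity
  constructor
  · have h3 : (((2 * L + 2) * N : ℕ) : ℤ) ≤ (((2 * L + 2) ^ (i.val + 1) * N : ℕ) : ℤ) := by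
      exact_mod_cast Nat.mul_le_mul_right N (hmul_ge L i)
    push_cast at h3 ⊢
    nlinarith
  · have h3 : (((2 * L + 2) ^ (i.val + 1) * N : ℕ) : ℤ) ≤ (((2 * L + 2) ^ t * N : ℕ) : ℤ) := by
      exact_mod_cast Nat.mul_le_mul_right N (hmul_le L i)
    push_cast at h3 ⊢
    nlinarith

/-! ### Box sums in `ℕ^t` and block summation with remainder -/

/-- A box of shift vectors with non-negative corners, transported to `ℕ^t`. -/
theorem sum_box_natCast (u : Fin t → ℕ) (X : Fin t → ℕ) (g : (Fin t → ℤ) → ℝ) :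
    ∑ b ∈ box (fun i => (u i : ℤ)) X, g b =
      ∑ x ∈ Fintype.piFinset (fun i => Ico (u i) (u i + (X i + 1))), g (fun i => (x i : ℤ)) := by
  symm
  refine Finset.sum_nbij' (fun x => fun i => (x i : ℤ)) (fun b => fun i => (b i).toNat) ?_ ?_ ?_ ?_ ?_
  · intro x hx
    rw [Fintype.mem_piFinset] at hx
    rw [mem_box_iff]
    intro i
    have := mem_Ico.1 (hx i)
    constructor
    · exact_mod_cast this.1
    · have h2 : x i ≤ u i + X i := by omega
      exact_mod_cast h2
  · intro b hb
    rw [mem_box_iff] at hb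
    rw [Fintype.mem_piFinset]
    intro i
    obtain ⟨h1, h2⟩ := hb i
    rw [mem_Ico]
    omega
  · intro x _
    funext i
    simp
  · intro b hb
    rw [mem_box_iff] at hb
    funext i
    exact Int.toNat_of_nonneg (le_trans (by positivity) (hb i).1)
  · intro x _
    rfl

/-- BLOCK SUMMATION over full periods: `Σ_{∏[u_i, u_i + m M)} G = m^t Σ_{[0,M)^t} G` for `M`-periodic `G`. -/
theorem block_sum_eq {M : ℕ} (hM : 0 < M) (u : Fin t → ℕ) (m : ℕ) (G : (Fin t → ℕ) → ℝ)
    (hG : ∀ x, G (Gallagher.modVec M x) = G x) :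
    ∑ x ∈ Fintype.piFinset (fun i => Ico (u i) (u i + m * M)), G x =
      (m : ℝ) ^ t * ∑ v ∈ Fintype.piFinset (fun _ : Fin t => range M), G v := by
  rw [CosetMeanProof.sum_piFinset_Ico_of_periodic' hM u (fun _ => m) G hG, Finset.prod_const,
    Finset.card_univ, Fintype.card_fin]

/-- BLOCK SUMMATION WITH REMAINDER: for an `M`-periodic `G` on `ℕ^t` and a box `∏_i [u_i, u_i + S)` with
`m M ≤ S ≤ (m+1) M`, `|Σ_box G − m^t Σ_{[0,M)^t} G| ≤ ((m+1)^t − m^t) Σ_{[0,M)^t} |G|`. -/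
theorem block_sum_remainder {M : ℕ} (hM : 0 < M) (u : Fin t → ℕ) {S m : ℕ} (hlo : m * M ≤ S)
    (hhi : S ≤ (m + 1) * M) (G : (Fin t → ℕ) → ℝ) (hG : ∀ x, G (Gallagher.modVec M x) = G x) :
    |∑ x ∈ Fintype.piFinset (fun i => Ico (u i) (u i + S)), G x
        - (m : ℝ) ^ t * ∑ v ∈ Fintype.piFinset (fun _ : Fin t => range M), G v|
      ≤ (((m + 1 : ℕ) : ℝ) ^ t - (m : ℝ) ^ t) *
          ∑ v ∈ Fintype.piFinset (fun _ : Fin t => range M), |G v| := by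
  set I := Fintype.piFinset (fun i => Ico (u i) (u i + S)) with hI
  set Im := Fintype.piFinset (fun i => Ico (u i) (u i + m * M)) with hIm
  set Ip := Fintype.piFinset (fun i => Ico (u i) (u i + (m + 1) * M)) with hIp
  have h1 : Im ⊆ I := Fintype.piFinset_subset _ _ fun i => Ico_subset_Ico le_rfl (by omega)
  have h2 : I ⊆ Ip := Fintype.piFinset_subset _ _ fun i => Ico_subset_Ico le_rfl (by omega)
  have hGabs : ∀ x, |G (Gallagher.modVec M x)| = |G x| := fun x => by rw [hG x]
  have eIm : ∑ x ∈ Im, G x = (m : ℝ) ^ t * ∑ v ∈ Fintype.piFinset (fun _ : Fin t => range M), G v :=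
    block_sum_eq hM u m G hG
  have eImabs : ∑ x ∈ Im, |G x| =
      (m : ℝ) ^ t * ∑ v ∈ Fintype.piFinset (fun _ : Fin t => range M), |G v| :=
    block_sum_eq hM u m (fun x => |G x|) hGabs
  have eIpabs : ∑ x ∈ Ip, |G x| =
      (((m + 1 : ℕ)) : ℝ) ^ t * ∑ v ∈ Fintype.piFinset (fun _ : Fin t => range M), |G v| :=
    block_sum_eq hM u (m + 1) (fun x => |G x|) hGabs
  have hdiff : ∑ x ∈ I, G x - ∑ x ∈ Im, G x = ∑ x ∈ I \ Im, G x := by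
    rw [← Finset.sum_sdiff h1]; ring
  have hdiff' : ∑ x ∈ Ip, |G x| - ∑ x ∈ Im, |G x| = ∑ x ∈ Ip \ Im, |G x| := by
    rw [← Finset.sum_sdiff (h1.trans h2)]; ring
  calc |∑ x ∈ I, G x - (m : ℝ) ^ t * ∑ v ∈ Fintype.piFinset (fun _ : Fin t => range M), G v|
      = |∑ x ∈ I \ Im, G x| := by rw [← eIm, hdiff]
    _ ≤ ∑ x ∈ I \ Im, |G x| := Finset.abs_sum_le_sum_abs _ _
    _ ≤ ∑ x ∈ Ip \ Im, |G x| :=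
        Finset.sum_le_sum_of_subset_of_nonneg (sdiff_subset_sdiff h2 le_rfl) fun _ _ _ => abs_nonneg _
    _ = _ := by rw [← hdiff', eIpabs, eImabs]; ring

/-- BLOCK SUMMATION, upper bound: for a non-negative `M`-periodic `G` and `S ≤ (m+1) M`,
`Σ_box G ≤ (m+1)^t Σ_{[0,M)^t} G`. -/
theorem block_sum_le {M : ℕ} (hM : 0 < M) (u : Fin t → ℕ) {S m : ℕ} (hhi : S ≤ (m + 1) * M)
    (G : (Fin t → ℕ) → ℝ) (hG : ∀ x, G (Gallagher.modVec M x) = G x) (hG0 : ∀ x, 0 ≤ G x) :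
    ∑ x ∈ Fintype.piFinset (fun i => Ico (u i) (u i + S)), G x ≤
      (((m + 1 : ℕ)) : ℝ) ^ t * ∑ v ∈ Fintype.piFinset (fun _ : Fin t => range M), G v := by
  rw [← block_sum_eq hM u (m + 1) G hG]
  exact Finset.sum_le_sum_of_subset_of_nonneg
    (Fintype.piFinset_subset _ _ fun i => Ico_subset_Ico le_rfl (by omega)) fun _ _ _ => hG0 _

/-- Registered hook (aux for `stub_typeData`): block summation with remainder. -/
theorem typeData_blockSum : ∀ {t M : ℕ}, 0 < M → ∀ (u : Fin t → ℕ) {S m : ℕ}, m * M ≤ S → S ≤ (m + 1) * M → ∀ (G : (Fin t → ℕ) → ℝ), (∀ x, G (Gallagher.modVec M x) = G x) → |∑ x ∈ Fintype.piFinset (fun i => Finset.Ico (u i) (u i + S)), G x - (m : ℝ) ^ t * ∑ v ∈ Fintype.piFinset (fun _ : Fin t => Finset.range M), G v| ≤ (((m + 1 : ℕ) : ℝ) ^ t - (m : ℝ) ^ t) * ∑ v ∈ Fintype.piFinset (fun _ : Fin t => Finset.range M), |G v| :=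
  fun hM u _ _ hlo hhi G hG => block_sum_remainder hM u hlo hhi G hG

end TypeDataProof

end Summit.Parity.GeneralizedHardyLittlewood.Cruxes.RelativeDimOne.TypeSplit

end
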